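import Literature.Geometry.ComplexAnalytic.RelativeExponentialChartFibreComparison
import Mathlib.Analysis.Calculus.ContDiff.Operations
import HarnessLib

/-!
# Comparison of relative exponential charts along a holomorphic map of families, II: one integral matrix, invertible (U6-d HEAD)

Layer `Literature/Geometry/ComplexAnalytic`, namespace `Literature.Geometry.ComplexAnalytic.IsRelExpChartOn`; sequel of
`RelativeExponentialChartFibreComparison.lean` (Part I: on each fibre `βM (ex′ (b′, z′)) = ex (β b′, L z′ + c)` with
`Φ (β b′) ∘ A_ℝ = L ∘ Φ′ b′`, and the linear part `L` is holomorphic in `b′`, operator-valued).  THEOREMS ONLY (no definition,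
no named fact, no instance, no notation, no `sorry`).  Cell hodgecm-mathlib (D-0151), P6 door (E), block U6, organ **U6-d**
(E6 owner A-p06 (g32) ROAD RULING 2026-09-01T22:14:53Z «(R-A) with (α)(β)(γ)»).  HC_CM is proved only modulo the printed
citations until rung 0 closes; this file is generic and changes no count.

* §3 `continuousOn_period_clm` ∕ `continuousOn_period_symm_clm` — operator-norm continuity of `b ↦ Φ b` and `b ↦ (Φ b)⁻¹` on
  `U` (columns continuous, finite-dimensional source; inversion is continuous at invertible operators, Mathlib
  `contDiffAt_map_inverse` ∕ `ContinuousLinearMap.inverse_equiv`); **`matrix_eq_of_isPreconnected`** — THE INTEGRAL PART IS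
  CONSTANT on a preconnected `U′` (its columns `(Φ (β b′))⁻¹ (L b′ (Φ′ b′ eⱼ))` are continuous INTEGER vectors;
  `Int.pairwise_one_le_dist`, `IsPreconnected.constant`).
* §4 **`exists_inverse_matrix_of_bijOn`** — (α) if `βM` is bijective between the fibres over `b′` and `β b′` then `A` is
  invertible over `ℤ`: the fibre map is a translate of the bijective continuous homomorphism `mapMatrix A` of compact tori,
  whose inverse is continuous (`Continuous.homeoOfEquivCompactToT2`), hence some `mapMatrix A′` (★
  `ComplexTorus.exists_eq_mapMatrix_of_continuous`), and `ρᵣ` is faithful (★ `mapMatrix_injective`, ★ `mapMatrix_mapMatrix`);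
  `comparison_of_zero` — (β) if the zero sections correspond the translation is a lattice vector and drops out.
* §5 HEAD **`exists_chartComparison`** ([LangeBirkenhake1992] Prop. 1.1.6 in families; model [Lange2023AbelianVarietiesComplex]
  §3.4.4 Lemma 3.4.7) — `U′` preconnected and non-empty, `β` continuous on `U′`, zero sections corresponding, `βM`
  fibrewise bijective: ONE `T ∈ GL(ℤ)` (two-sided inverse `T′`) and a holomorphic operator-valued `L` with every `L b′`
  bijective, `Φ (β b′) ∘ T_ℝ = L b′ ∘ Φ′ b′`, `βM (ex′ (b′, z′)) = ex (β b′, L b′ z′)`; corollary **`exists_transition`** (`β = id`,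
  `βM = id`: the transition between two charts of ONE family — the sheet law U6-c exports, with named integral part).
CONSUMERS: E6 (A-p06 ROAD MAP v1: the U6-a chart of `P.A^an` read against U6-c's Kuga chart through `G^an`; `N := T⁻¹ M T`,
`C := L⁻¹ ∘ Cb ∘ L`), U6-c (A-p12: charts per sheet of `unif_c` and their `Γ_δ(N)`-transformation law).

## References
* [LangeBirkenhake1992] H. Lange, Ch. Birkenhake, *Complex Abelian Varieties* (1992), §1.1.2 Prop. 1.1.6 (store key of
  record; numbering = Lange 2023 text edition §1.1).
* [Lange2023AbelianVarietiesComplex] H. Lange, *Abelian Varieties over the Complex Numbers* (2023), §3.4.1 Prop. 3.4.1,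
  §3.4.4 Lemma 3.4.7 (held `book:lange1992-complex-abelian-varieties` p0180–p0184).
-/

set_option autoImplicit false

noncomputable section

open scoped Manifold ContDiff Topology Matrix
open Set Function Filter
open Literature.Geometry.Kaehler (ComplexTorus)
open Literature.Geometry.Kaehler.ComplexTorus (cover latticeVec mapMatrix)

namespace Literature.Geometry.ComplexAnalytic.IsRelExpChartOn

variable {EB : Type*} [NormedAddCommGroup EB] [NormedSpace ℂ EB] {B : Type*} [TopologicalSpace B] [ChartedSpace EB B]
  {E : Type*} [NormedAddCommGroup E] [NormedSpace ℂ E] {ι : Type*} [Fintype ι]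
  {EM : Type*} [NormedAddCommGroup EM] [NormedSpace ℂ EM] {M : Type*} [TopologicalSpace M] [ChartedSpace EM M]
  {EB' : Type*} [NormedAddCommGroup EB'] [NormedSpace ℂ EB'] {B' : Type*} [TopologicalSpace B'] [ChartedSpace EB' B']
  {E' : Type*} [NormedAddCommGroup E'] [NormedSpace ℂ E'] {ι' : Type*} [Fintype ι']
  {EM' : Type*} [NormedAddCommGroup EM'] [NormedSpace ℂ EM'] {M' : Type*} [TopologicalSpace M'] [ChartedSpace EM' M']
  {p : M → B} {U : Set B} {Φ : B → ((ι → ℝ) ≃L[ℝ] E)} {ex : B × E → M}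
  {p' : M' → B'} {U' : Set B'} {Φ' : B' → ((ι' → ℝ) ≃L[ℝ] E')} {ex' : B' × E' → M'}
  {β : B' → B} {βM : M' → M}

/-! ### §3 The integral part is locally constant -/

omit [Fintype ι'] in
/-- The period family of a chart is continuous on `U` IN OPERATOR NORM (its columns `b ↦ Φ b eᵢ` are continuous and the
source `ι → ℝ` is finite-dimensional). [cite: Lange2023AbelianVarietiesComplex, §3.4.1 Prop. 3.4.1] -/
theorem continuousOn_period_clm [DecidableEq ι] (h : IsRelExpChartOn EB EM p U Φ ex) :
    ContinuousOn (fun b ↦ (Φ b : (ι → ℝ) →L[ℝ] E)) U := by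
  have hsum : ∀ b, (Φ b : (ι → ℝ) →L[ℝ] E) =
      ∑ i, ContinuousLinearMap.smulRightL ℝ (ι → ℝ) E (ContinuousLinearMap.proj i) (Φ b (Pi.single i 1)) := by
    intro b
    ext x
    have happ : ∀ (f : ι → ((ι → ℝ) →L[ℝ] E)) (v : ι → ℝ), (∑ i, f i) v = ∑ i, f i v :=
      fun f v ↦ by simp
    rw [happ]
    simp only [ContinuousLinearMap.smulRightL_apply_apply, ContinuousLinearMap.smulRight_apply,
      ContinuousLinearMap.proj_apply, ContinuousLinearEquiv.coe_coe]
    conv_lhs => rw [← Finset.univ_sum_single x]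
    rw [map_sum]
    refine Finset.sum_congr rfl fun i _ ↦ ?_
    have hsingle : (Pi.single i (x i) : ι → ℝ) = x i • (Pi.single i (1 : ℝ) : ι → ℝ) := by
      ext k
      by_cases hk : k = i
      · subst hk; simp
      · simp [Pi.single_eq_of_ne hk]
    rw [hsingle, map_smul]
  have hterm : ∀ i, ContinuousOn
      (fun b ↦ ContinuousLinearMap.smulRightL ℝ (ι → ℝ) E (ContinuousLinearMap.proj i) (Φ b (Pi.single i 1))) U :=
    fun i ↦ (ContinuousLinearMap.smulRightL ℝ (ι → ℝ) E (ContinuousLinearMap.proj i)).continuous.comp_continuousOn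
      (h.mdifferentiableOn_period (Pi.single i 1)).continuousOn
  exact (continuousOn_finsetSum Finset.univ fun i _ ↦ hterm i).congr fun b _ ↦ hsum b

omit [Fintype ι'] in
/-- The INVERSE period maps `b ↦ (Φ b)⁻¹` are continuous on `U` in operator norm (inversion is continuous at invertible
operators, Mathlib `contDiffAt_map_inverse`). [cite: Lange2023AbelianVarietiesComplex, §3.4.1 Prop. 3.4.1] -/
theorem continuousOn_period_symm_clm [DecidableEq ι] (h : IsRelExpChartOn EB EM p U Φ ex) :
    ContinuousOn (fun b ↦ ((Φ b).symm : E →L[ℝ] (ι → ℝ))) U := by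
  intro b₀ hb₀
  have hinv : ContinuousAt (ContinuousLinearMap.inverse : ((ι → ℝ) →L[ℝ] E) → (E →L[ℝ] (ι → ℝ)))
      (Φ b₀ : (ι → ℝ) →L[ℝ] E) :=
    (contDiffAt_map_inverse (𝕜 := ℝ) (n := 0) (Φ b₀)).continuousAt
  have hcomp : ContinuousWithinAt (fun b ↦ ContinuousLinearMap.inverse (Φ b : (ι → ℝ) →L[ℝ] E)) U b₀ :=
    ContinuousAt.comp_continuousWithinAt (f := fun b ↦ (Φ b : (ι → ℝ) →L[ℝ] E)) hinv
      (h.continuousOn_period_clm b₀ hb₀)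
  refine hcomp.congr (fun b _ ↦ ?_) ?_
  · exact (ContinuousLinearMap.inverse_equiv (Φ b)).symm
  · exact (ContinuousLinearMap.inverse_equiv (Φ b₀)).symm

/-- **THE INTEGRAL PART IS LOCALLY CONSTANT, hence CONSTANT on a preconnected `U′`**: if `Φ (β b′) ∘ A(b′)_ℝ = L b′ ∘ Φ′ b′`
on `U′` with `L` the (holomorphic) linear part of the comparison and `β` continuous on `U′`, then `A b₁ = A b₂` for all
`b₁, b₂ ∈ U′` — the columns `(Φ (β b′))⁻¹ (L b′ (Φ′ b′ eⱼ))` are continuous integer vectors.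
[cite: LangeBirkenhake1992, §1.1.2 (the rational representation is integral)] -/
theorem matrix_eq_of_isPreconnected [DecidableEq ι] [DecidableEq ι'] [FiniteDimensional ℂ E']
    (h : IsRelExpChartOn EB EM p U Φ ex) (h' : IsRelExpChartOn EB' EM' p' U' Φ' ex')
    (hβM : MDifferentiable 𝓘(ℂ, EM') 𝓘(ℂ, EM) βM) (hover : ∀ m', p' m' ∈ U' → p (βM m') = β (p' m'))
    (hβ : MapsTo β U' U) (hβc : ContinuousOn β U')
    {A : B' → Matrix ι ι' ℤ} {L : B' → (E' →L[ℂ] E)} {c : B' → E}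
    (hA : ∀ b' ∈ U', ∀ x, Φ (β b') (((A b').map (Int.cast : ℤ → ℝ)) *ᵥ x) = L b' (Φ' b' x))
    (hLc : ∀ b' ∈ U', ∀ z', βM (ex' (b', z')) = ex (β b', L b' z' + c b'))
    (hU' : IsPreconnected U') {b₁ b₂ : B'} (hb₁ : b₁ ∈ U') (hb₂ : b₂ ∈ U') : A b₁ = A b₂ := by
  -- the `j`-th column of `A b'`, read in `ℝ^ι`, is a continuous function of `b' ∈ U'`
  have hcol : ∀ j, ContinuousOn (fun b' ↦ fun i ↦ ((A b' i j : ℤ) : ℝ)) U' := by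
    intro j
    have hL : ContinuousOn (fun b' ↦ L b' (Φ' b' (Pi.single j 1))) U' :=
      (h.mdifferentiableOn_linearPart h' hβM hover hβ hLc).continuousOn.clm_apply
        (h'.mdifferentiableOn_period (Pi.single j 1)).continuousOn
    have hΦ : ContinuousOn (fun b' ↦ ((Φ (β b')).symm : E →L[ℝ] (ι → ℝ))) U' :=
      h.continuousOn_period_symm_clm.comp hβc hβ
    refine (hΦ.clm_apply hL).congr fun b' hb' ↦ ?_
    have h1 := hA b' hb' (Pi.single j 1)
    rw [Matrix.mulVec_single_one] at h1
    show (fun i ↦ ((A b' i j : ℤ) : ℝ)) = ((Φ (β b')).symm : E →L[ℝ] (ι → ℝ)) (L b' (Φ' b' (Pi.single j 1)))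
    rw [ContinuousLinearEquiv.coe_coe, ← h1, ContinuousLinearEquiv.symm_apply_apply]
    funext i
    simp [Matrix.col_apply, Matrix.map_apply]
  -- hence each entry is a continuous integer-valued function, constant on the preconnected `U'`
  ext i j
  have hent : ContinuousOn (fun b' ↦ A b' i j) U' := by
    intro b₀ hb₀
    have hc := (hcol j b₀ hb₀)
    -- eventually the real columns are at distance `< 1`, hence the integer entries agree
    have hev : ∀ᶠ b' in 𝓝[U'] b₀, A b' i j = A b₀ i j := by
      have := Metric.tendsto_nhds.1 hc 1 one_pos
      filter_upwards [this] with b' hb'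
      have hi : dist (((A b' i j : ℤ) : ℝ)) ((A b₀ i j : ℤ) : ℝ) < 1 :=
        lt_of_le_of_lt (dist_le_pi_dist (fun i ↦ ((A b' i j : ℤ) : ℝ)) (fun i ↦ ((A b₀ i j : ℤ) : ℝ)) i) hb'
      rw [Int.dist_cast_real] at hi
      by_contra hne
      exact absurd (Int.pairwise_one_le_dist hne) (not_le.2 hi)
    exact (continuousWithinAt_const (b := A b₀ i j)).congr_of_eventuallyEq hev rfl
  exact hU'.constant hent hb₁ hb₂

/-! ### §4 Fibrewise bijective comparisons have invertible integral part -/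

/-- **(α) If `βM` is BIJECTIVE between the fibres over `b′` and `β b′`, the integral part `A` is invertible over `ℤ`**:
the induced map of tori is a translate of the bijective continuous homomorphism `mapMatrix A`, whose inverse (continuous:
compact to Hausdorff) is again `mapMatrix A′` (★ `exists_eq_mapMatrix_of_continuous`), and `ρᵣ` is faithful.
[cite: LangeBirkenhake1992, §1.1.2 Prop. 1.1.6] -/
theorem exists_inverse_matrix_of_bijOn [DecidableEq ι] [DecidableEq ι'] (h : IsRelExpChartOn EB EM p U Φ ex)
    (h' : IsRelExpChartOn EB' EM' p' U' Φ' ex') (hβ : MapsTo β U' U) {b' : B'} (hb' : b' ∈ U')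
    (hbij : BijOn βM (p' ⁻¹' {b'}) (p ⁻¹' {β b'}))
    {A : Matrix ι ι' ℤ} {L : E' →L[ℂ] E} {c : E} (hA : ∀ x, Φ (β b') ((A.map (Int.cast : ℤ → ℝ)) *ᵥ x) = L (Φ' b' x))
    (hLc : ∀ z', βM (ex' (b', z')) = ex (β b', L z' + c)) :
    ∃ A' : Matrix ι' ι ℤ, A' * A = 1 ∧ A * A' = 1 := by
  have hb : β b' ∈ U := hβ hb'
  set G : ComplexTorus (Φ' b') →+ ComplexTorus (Φ (β b')) :=
    AddMonoidHom.mk' (mapMatrix (Φ' b') (Φ (β b')) A) (ComplexTorus.mapMatrix_add A) with hG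
  -- the translate `t' ↦ G t' + π c` is the map induced by `βM` on the fibre tori
  have hF : ∀ t', h.fibreMap (β b') (G t' + cover (Φ (β b')) c) = βM (h'.fibreMap b' t') := by
    intro t'
    obtain ⟨z', rfl⟩ := ComplexTorus.cover_surjective (Φ' b') t'
    rw [h'.fibreMap_cover hb', hLc z', hG, AddMonoidHom.mk'_apply,
      ← ComplexTorus.cover_apply_eq_mapMatrix_cover hA z', ← ComplexTorus.cover_add, h.fibreMap_cover hb]
  -- it is bijective
  have hGbij : Bijective G := by
    have hinj : Injective fun t' ↦ G t' + cover (Φ (β b')) c := by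
      intro t₁ t₂ ht
      have h1 : βM (h'.fibreMap b' t₁) = βM (h'.fibreMap b' t₂) := by rw [← hF t₁, ← hF t₂]; exact congrArg _ ht
      exact h'.fibreMap_injective hb' (hbij.injOn (h'.p_fibreMap hb' t₁) (h'.p_fibreMap hb' t₂) h1)
    have hsurj : Surjective fun t' ↦ G t' + cover (Φ (β b')) c := by
      intro t
      have ht : h.fibreMap (β b') t ∈ p ⁻¹' {β b'} := h.p_fibreMap hb t
      obtain ⟨m', hm', hm't⟩ := hbij.surjOn ht
      have hm'r : m' ∈ range (h'.fibreMap b') := by rw [h'.range_fibreMap hb']; exact hm'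
      obtain ⟨t', rfl⟩ := hm'r
      exact ⟨t', h.fibreMap_injective hb ((hF t').trans hm't)⟩
    refine ⟨fun t₁ t₂ ht ↦ hinj (show G t₁ + cover (Φ (β b')) c = G t₂ + cover (Φ (β b')) c by rw [ht]),
      fun t ↦ ?_⟩
    obtain ⟨t', ht'⟩ := hsurj (t + cover (Φ (β b')) c)
    exact ⟨t', add_right_cancel ht'⟩
  -- its inverse is a continuous homomorphism, hence `mapMatrix A'`
  set Ge : ComplexTorus (Φ' b') ≃+ ComplexTorus (Φ (β b')) := AddEquiv.ofBijective G hGbij with hGe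
  have hGc : Continuous Ge := ComplexTorus.continuous_mapMatrix A
  have hsymmc : Continuous Ge.symm := by
    have := (Continuous.homeoOfEquivCompactToT2 (f := Ge.toEquiv) hGc).symm.continuous
    exact this
  obtain ⟨A', hA'⟩ := ComplexTorus.exists_eq_mapMatrix_of_continuous (h := Ge.symm.toAddMonoidHom) hsymmc
  rw [AddEquiv.coe_toAddMonoidHom] at hA'
  have hGapply : ∀ t', Ge t' = mapMatrix (Φ' b') (Φ (β b')) A t' := fun t' ↦ rfl
  refine ⟨A', ComplexTorus.mapMatrix_injective (Φ := Φ' b') (Φ' := Φ' b') (funext fun t' ↦ ?_),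
    ComplexTorus.mapMatrix_injective (Φ := Φ (β b')) (Φ' := Φ (β b')) (funext fun t ↦ ?_)⟩
  · rw [← ComplexTorus.mapMatrix_mapMatrix (Φ := Φ' b') (Φ' := Φ (β b')) (Φ'' := Φ' b') A' A t',
      ComplexTorus.mapMatrix_one, ← hGapply, ← hA', AddEquiv.symm_apply_apply]
  · rw [← ComplexTorus.mapMatrix_mapMatrix (Φ := Φ (β b')) (Φ' := Φ' b') (Φ'' := Φ (β b')) A A' t,
      ComplexTorus.mapMatrix_one, ← hA', ← hGapply, AddEquiv.apply_symm_apply]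

omit [Fintype ι] [TopologicalSpace B'] [ChartedSpace EB' B'] [TopologicalSpace M'] [ChartedSpace EM' M'] in
/-- **(β) If the zero sections correspond, the translation part is a lattice vector** (so it can be dropped:
`ex (β b′, L z′ + c) = ex (β b′, L z′)`). [cite: LangeBirkenhake1992, §1.1.2 Prop. 1.1.6] -/
theorem comparison_of_zero (h : IsRelExpChartOn EB EM p U Φ ex) (hβ : MapsTo β U' U) {b' : B'} (hb' : b' ∈ U')
    (hzero : βM (ex' (b', 0)) = ex (β b', 0)) {L : E' →L[ℂ] E} {c : E}
    (hLc : ∀ z', βM (ex' (b', z')) = ex (β b', L z' + c)) (z' : E') : βM (ex' (b', z')) = ex (β b', L z') := by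
  obtain ⟨n, hn⟩ := h.exists_int_of_ex_eq (hβ hb') ((hLc 0).symm.trans hzero)
  rw [map_zero, zero_add] at hn
  -- `0 = c + Φ n`, so `c = -Φ n` is a lattice vector
  have hc : c = latticeVec (Φ (β b')) (-n) := by
    have : c = -(Φ (β b') fun i ↦ (n i : ℝ)) := eq_neg_of_add_eq_zero_left hn.symm
    rw [this, latticeVec, ← map_neg]
    congr 1
    funext i
    simp
  rw [hLc z', hc, h.ex_add_latticeVec (hβ hb')]


/-! ### §5 HEAD: chart comparison along a holomorphic map of families -/

omit [Fintype ι] [Fintype ι'] in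
/-- Integer matrices with `T′ T = 1` act invertibly on real vectors (plumbing). [folklore] -/
private theorem mulVec_mulVec_cast_of_mul_eq_one [Fintype ι] [Fintype ι'] [DecidableEq ι'] {T : Matrix ι ι' ℤ}
    {T' : Matrix ι' ι ℤ} (hT : T' * T = 1) (x : ι' → ℝ) :
    (T'.map (Int.cast : ℤ → ℝ)) *ᵥ ((T.map (Int.cast : ℤ → ℝ)) *ᵥ x) = x := by
  have hmap : (T' * T).map (Int.cast : ℤ → ℝ) = T'.map (Int.cast : ℤ → ℝ) * T.map (Int.cast : ℤ → ℝ) := by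
    simpa using (Matrix.map_mul (L := T') (M := T) (f := Int.castRingHom ℝ))
  rw [Matrix.mulVec_mulVec, ← hmap, hT, Matrix.map_one _ Int.cast_zero Int.cast_one, Matrix.one_mulVec]

/-- **(U6-d HEAD) CHART COMPARISON ALONG A HOLOMORPHIC MAP OF FAMILIES** ([LangeBirkenhake1992] Prop. 1.1.6 in families;
[Lange2023AbelianVarietiesComplex] §3.4.4 Lemma 3.4.7 is the model case `βM = ` the `G_D`-action on `𝔛_D → 𝔥_g`).  Let
`h′`, `h` be relative exponential charts of `p′ : M′ → B′` over `U′` and of `p : M → B` over `U`, `βM : M′ → M` holomorphic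
over `β : B′ → B` (`β` continuous on `U′`, `β U′ ⊆ U`), with `U′` preconnected and non-empty, ZERO SECTIONS CORRESPONDING
(`βM (ex′ (b′, 0)) = ex (β b′, 0)`) and `βM` BIJECTIVE between the fibres over `b′` and `β b′` for every `b′ ∈ U′`.  Then there are
ONE integer matrix `T`, invertible over `ℤ` (inverse `T′`), and an operator-valued HOLOMORPHIC `L : B′ → (E′ →L[ℂ] E)` on `U′`
with every `L b′` bijective, such that `Φ (β b′) ∘ T_ℝ = L b′ ∘ Φ′ b′` (the lattice frames correspond under `T`) and
`βM (ex′ (b′, z′)) = ex (β b′, L b′ z′)` on `U′ × E′`.  E6 reads its U6-a chart of `P.A^an` against the Kuga chart through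
`G^an` with this (`N := T⁻¹ M T`, `C := L⁻¹ ∘ Cb ∘ L`). [cite: LangeBirkenhake1992, §1.1.2 Proposition 1.1.6]
[cite: Lange2023AbelianVarietiesComplex, §3.4.4 Lemma 3.4.7] -/
theorem exists_chartComparison [DecidableEq ι] [DecidableEq ι'] [FiniteDimensional ℂ E']
    (h : IsRelExpChartOn EB EM p U Φ ex) (h' : IsRelExpChartOn EB' EM' p' U' Φ' ex')
    (hβM : MDifferentiable 𝓘(ℂ, EM') 𝓘(ℂ, EM) βM) (hover : ∀ m', p' m' ∈ U' → p (βM m') = β (p' m'))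
    (hβ : MapsTo β U' U) (hβc : ContinuousOn β U') (hU' : IsPreconnected U') (hne : U'.Nonempty)
    (hzero : ∀ b' ∈ U', βM (ex' (b', 0)) = ex (β b', 0))
    (hbij : ∀ b' ∈ U', BijOn βM (p' ⁻¹' {b'}) (p ⁻¹' {β b'})) :
    ∃ (T : Matrix ι ι' ℤ) (T' : Matrix ι' ι ℤ) (L : B' → (E' →L[ℂ] E)),
      T' * T = 1 ∧ T * T' = 1 ∧
      MDifferentiableOn 𝓘(ℂ, EB') 𝓘(ℂ, E' →L[ℂ] E) L U' ∧
      (∀ b' ∈ U', Bijective (L b')) ∧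
      (∀ b' ∈ U', ∀ x, Φ (β b') ((T.map (Int.cast : ℤ → ℝ)) *ᵥ x) = L b' (Φ' b' x)) ∧
      ∀ b' ∈ U', ∀ z', βM (ex' (b', z')) = ex (β b', L b' z') := by
  classical
  -- pointwise data (§1), junk off `U'`
  have hpt : ∀ b', ∃ (A : Matrix ι ι' ℤ) (L : E' →L[ℂ] E) (c : E), b' ∈ U' →
      (∀ x, Φ (β b') ((A.map (Int.cast : ℤ → ℝ)) *ᵥ x) = L (Φ' b' x)) ∧
        ∀ z', βM (ex' (b', z')) = ex (β b', L z' + c) := by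
    intro b'
    by_cases hb' : b' ∈ U'
    · obtain ⟨A, L, c, hA, hLc⟩ := h.exists_affine_comparison_fibre h' hβM hover hβ hb'
      exact ⟨A, L, c, fun _ ↦ ⟨hA, hLc⟩⟩
    · exact ⟨0, 0, 0, fun hb ↦ (hb' hb).elim⟩
  choose A L c hALc using hpt
  have hA : ∀ b' ∈ U', ∀ x, Φ (β b') (((A b').map (Int.cast : ℤ → ℝ)) *ᵥ x) = L b' (Φ' b' x) :=
    fun b' hb' ↦ (hALc b' hb').1
  -- (β) drop the translations
  have hL0 : ∀ b' ∈ U', ∀ z', βM (ex' (b', z')) = ex (β b', L b' z') := fun b' hb' z' ↦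
    h.comparison_of_zero hβ hb' (hzero b' hb') (hALc b' hb').2 z'
  have hL0' : ∀ b' ∈ U', ∀ z', βM (ex' (b', z')) = ex (β b', L b' z' + (fun _ : B' ↦ (0 : E)) b') :=
    fun b' hb' z' ↦ by rw [add_zero]; exact hL0 b' hb' z'
  -- (γ) holomorphy of `L`
  have hLd : MDifferentiableOn 𝓘(ℂ, EB') 𝓘(ℂ, E' →L[ℂ] E) L U' :=
    h.mdifferentiableOn_linearPart h' hβM hover hβ hL0'
  -- ONE matrix on the preconnected `U'`
  obtain ⟨b₀, hb₀⟩ := hne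
  have hAc : ∀ b' ∈ U', A b' = A b₀ := fun b' hb' ↦
    h.matrix_eq_of_isPreconnected h' hβM hover hβ hβc hA hL0' hU' hb' hb₀
  -- (α) invertibility at `b₀`
  obtain ⟨T', hT'T, hTT'⟩ := h.exists_inverse_matrix_of_bijOn h' hβ hb₀ (hbij b₀ hb₀) (hA b₀ hb₀) (hALc b₀ hb₀).2
  have hT : ∀ b' ∈ U', ∀ x, Φ (β b') (((A b₀).map (Int.cast : ℤ → ℝ)) *ᵥ x) = L b' (Φ' b' x) :=
    fun b' hb' x ↦ by rw [← hAc b' hb']; exact hA b' hb' x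
  refine ⟨A b₀, T', L, hT'T, hTT', hLd, fun b' hb' ↦ ⟨fun v w hvw ↦ ?_, fun v ↦ ?_⟩, hT, hL0⟩
  · -- injective
    obtain ⟨x, rfl⟩ := (Φ' b').surjective v
    obtain ⟨y, rfl⟩ := (Φ' b').surjective w
    rw [← hT b' hb' x, ← hT b' hb' y] at hvw
    have hxy := congrArg (fun u ↦ (T'.map (Int.cast : ℤ → ℝ)) *ᵥ u) ((Φ (β b')).injective hvw)
    simp only [mulVec_mulVec_cast_of_mul_eq_one hT'T] at hxy
    rw [hxy]
  · -- surjective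
    refine ⟨Φ' b' ((T'.map (Int.cast : ℤ → ℝ)) *ᵥ (Φ (β b')).symm v), ?_⟩
    rw [← hT b' hb', mulVec_mulVec_cast_of_mul_eq_one hTT', ContinuousLinearEquiv.apply_symm_apply]

/-- **TRANSITION BETWEEN TWO CHARTS OF ONE FAMILY** (the case `β = id`, `βM = id` of the HEAD — the sheet law U6-c
exports, with NAMED integral part): two relative exponential charts `ex₁` (over `U₁`, frames `Φ₁`, index `ι`) and `ex₂`
(over `U₂`, frames `Φ₂`, index `ι′`) of the same family `p : M → B` whose zero sections agree on a preconnected non-empty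
open `V ⊆ U₁ ∩ U₂` differ there by ONE `T ∈ GL(ℤ)` on the lattices and a holomorphic fibrewise linear isomorphism:
`ex₂ (b, z′) = ex₁ (b, L b z′)`, `Φ₁ b ∘ T_ℝ = L b ∘ Φ₂ b`. [cite: LangeBirkenhake1992, §1.1.2 Proposition 1.1.6]
[cite: Lange2023AbelianVarietiesComplex, §3.4.4 Lemma 3.4.7] -/
theorem exists_transition [DecidableEq ι] [DecidableEq ι'] [FiniteDimensional ℂ E']
    {Φ₂ : B → ((ι' → ℝ) ≃L[ℝ] E')} {ex₂ : B × E' → M} {U₂ V : Set B}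
    (h₁ : IsRelExpChartOn EB EM p U Φ ex) (h₂ : IsRelExpChartOn EB EM p U₂ Φ₂ ex₂)
    (hV : IsOpen V) (hVU : V ⊆ U) (hVU₂ : V ⊆ U₂) (hVc : IsPreconnected V) (hne : V.Nonempty)
    (hzero : ∀ b ∈ V, ex₂ (b, 0) = ex (b, 0)) :
    ∃ (T : Matrix ι ι' ℤ) (T' : Matrix ι' ι ℤ) (L : B → (E' →L[ℂ] E)),
      T' * T = 1 ∧ T * T' = 1 ∧
      MDifferentiableOn 𝓘(ℂ, EB) 𝓘(ℂ, E' →L[ℂ] E) L V ∧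
      (∀ b ∈ V, Bijective (L b)) ∧
      (∀ b ∈ V, ∀ x, Φ b ((T.map (Int.cast : ℤ → ℝ)) *ᵥ x) = L b (Φ₂ b x)) ∧
      ∀ b ∈ V, ∀ z', ex₂ (b, z') = ex (b, L b z') :=
  h₁.exists_chartComparison (h₂.mono hV hVU₂) (β := id) (βM := id) mdifferentiable_id (fun _ _ ↦ rfl)
    (fun _ hb ↦ hVU hb) continuousOn_id hVc hne (fun b hb ↦ hzero b hb) fun _ _ ↦ bijOn_id _

end Literature.Geometry.ComplexAnalytic.IsRelExpChartOn

end
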